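import Summits.AtomisticToContinuum.Crystallization.Theorems.SlackRigidity.Negative.WitnessBasics
import Literature.MathematicalPhysics.StatisticalMechanics.BarlowStacking
import Literature.MathematicalPhysics.StatisticalMechanics.HcpHomogeneous
import HarnessLib

/-!
# Line `c-layer-witness-strictness` (crux `SlackRigidity`, stmt-AtomisticToContinuum-11960): the c-layer witness selects hcp

Stub `stub_witness` of the line skeleton (pure Barlow-stacking arithmetic, no energetics): a
Barlow stacking `barlowStacking a h s` (`s` a `±1` Hägg sequence) none of whose pair distances has
square `16a²/3 + 4h²` is the hexagonal close packing `hcpStacking a h` up to a linear isometry of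
`ℝ³` (the identity or the half-turn about `e₃`).

Proof.
* (contrapositive core, `exists_dist_sq_eq_of_succ_eq`) a cubic letter `s (m+1) = s m =: σ` gives the
  label difference `haggLabel s (m+2) − haggLabel s m = 2σ` (`haggLabel_succ` twice), and then by
  `dist_barlowPos_sq` the two points `barlowPos (m+2) 0 0`, `barlowPos m (2σ) (−2σ)` of the stacking
  are at squared distance `0 + (a√3/2 · 8σ/3)² + (2h)² = 16a²/3 + 4h²`;
* hence the word alternates, `s (m+1) = −s m`, so `s m = s 0 · alternatingHagg m` (integer
  induction), i.e. `s = alternatingHagg` (and `B = id`) or `s = −alternatingHagg`;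
* for the negated sequence the labels are negated (`haggLabel_neg`), and the coordinates
  (`barlowPos_apply_zero/one/two`) give `barlowPos (−alt) k i j = halfTurn (barlowPos alt k (−i) (−j))`,
  so the stacking is `halfTurn '' hcpStacking a h`.

References: Conway–Sloane, *SPLAG* Ch. 1 §1.3; Hales, *Dense Sphere Packings* §1.3;
Pártay–Ortner–Bartók–Pickard–Csányi, PCCP 19 (2017) App. A.  All `[folklore]`.
-/

noncomputable section

namespace Summit.AtomisticToContinuum.Crystallization.Theorems.CLayerWitnessWitness

open Literature.MathematicalPhysics.StatisticalMechanics
open Summit.AtomisticToContinuum.Crystallization.Theorems.SlackRigidityNegative (E3)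

/-! ## The contrapositive core: a cubic letter realises the witness distance -/

/-- **A cubic letter realises the c-layer witness distance.** If `s (m+1) = s m` (`s` a `±1`
sequence) then the points `barlowPos (m+2) 0 0` and `barlowPos m (2 s m) (−2 s m)` of the stacking
are at squared distance `16a²/3 + 4h²`. [folklore] -/
theorem exists_dist_sq_eq_of_succ_eq (a h : ℝ) {s : ℤ → ℤ} (hs : IsHaggSeq s) {m : ℤ}
    (hm : s (m + 1) = s m) :
    ∃ x ∈ barlowStacking a h s, ∃ y ∈ barlowStacking a h s,
      dist x y ^ 2 = 16 * a ^ 2 / 3 + 4 * h ^ 2 := by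
  refine ⟨_, barlowPos_mem (m + 2) 0 0, _, barlowPos_mem m (2 * s m) (-(2 * s m)), ?_⟩
  have hL : haggLabel s (m + 2) = haggLabel s m + 2 * s m := by
    rw [show m + 2 = m + 1 + 1 by ring, haggLabel_succ, haggLabel_succ, hm]; ring
  have h3 : (√3 : ℝ) ^ 2 = 3 := Real.sq_sqrt (by norm_num)
  have hσ2 : ((s m : ℤ) : ℝ) ^ 2 = 1 := by rcases hs m with h | h <;> rw [h] <;> norm_num
  rw [dist_barlowPos_sq, hL]
  push_cast
  linear_combination (16 / 9 * a ^ 2 * (s m : ℝ) ^ 2) * h3 + (16 / 3 * a ^ 2) * hσ2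

/-- **No witness distance ⇒ the word alternates**: `s (m+1) = −s m` for every `m`. [folklore] -/
theorem succ_eq_neg_of_forall_dist_sq_ne (a h : ℝ) {s : ℤ → ℤ} (hs : IsHaggSeq s)
    (hnot : ∀ x ∈ barlowStacking a h s, ∀ y ∈ barlowStacking a h s,
      dist x y ^ 2 ≠ 16 * a ^ 2 / 3 + 4 * h ^ 2) (m : ℤ) :
    s (m + 1) = -s m := by
  by_contra hne
  have hm : s (m + 1) = s m := by
    rcases hs m with h0 | h0 <;> rcases hs (m + 1) with h1 | h1 <;> omega
  obtain ⟨x, hx, y, hy, hxy⟩ := exists_dist_sq_eq_of_succ_eq a h hs hm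
  exact hnot x hx y hy hxy

/-! ## Alternating words are `±alternatingHagg` -/

/-- `alternatingHagg (m+1) = −alternatingHagg m`. [folklore] -/
theorem alternatingHagg_succ (m : ℤ) : alternatingHagg (m + 1) = -alternatingHagg m := by
  by_cases hm : Even m
  · have h1 : ¬ Even (m + 1) := by rwa [Int.even_add_one, not_not]
    simp [alternatingHagg, hm, h1]
  · have h1 : Even (m + 1) := by rwa [Int.even_add_one]
    simp [alternatingHagg, hm, h1]

/-- An alternating `±1` word is `s 0 · alternatingHagg`. [folklore] -/
theorem eq_mul_alternatingHagg {s : ℤ → ℤ} (halt : ∀ m, s (m + 1) = -s m) (m : ℤ) :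
    s m = s 0 * alternatingHagg m := by
  induction m with
  | zero => simp [alternatingHagg]
  | succ n ih => rw [halt, ih, alternatingHagg_succ]; ring
  | pred n ih =>
    have h1 := halt (-(n : ℤ) - 1)
    have h2 := alternatingHagg_succ (-(n : ℤ) - 1)
    rw [sub_add_cancel] at h1 h2
    rw [h1, h2] at ih
    linear_combination -ih

/-! ## The negated alternating word is the half-turned hcp -/

/-- Negating the Hägg sequence negates the layer labels. [folklore] -/
theorem haggLabel_neg (s : ℤ → ℤ) (k : ℤ) : haggLabel (fun m => -s m) k = -haggLabel s k := by
  have hw : ∀ (m : ℤ) (n : ℕ), haggWindow (fun m => -s m) m n = -haggWindow s m n := fun m n => by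
    simp [haggWindow, Finset.sum_neg_distrib]
  unfold haggLabel
  split_ifs <;> simp [hw]

/-- **The stacking of `−alternatingHagg` is the half-turned hcp, pointwise**:
`barlowPos (−alt) k i j = halfTurn (barlowPos alt k (−i) (−j))`. [folklore] -/
theorem barlowPos_neg_alternating (a h : ℝ) (k i j : ℤ) :
    barlowPos a h (fun m => -alternatingHagg m) k i j =
      halfTurn (barlowPos a h alternatingHagg k (-i) (-j)) := by
  have hL := haggLabel_neg alternatingHagg k
  ext l
  fin_cases l <;> simp [hL] <;> ring

/-- The same identity read backwards: `halfTurn (barlowPos alt k i j) = barlowPos (−alt) k (−i) (−j)`.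
[folklore] -/
theorem halfTurn_barlowPos_alternating (a h : ℝ) (k i j : ℤ) :
    halfTurn (barlowPos a h alternatingHagg k i j) =
      barlowPos a h (fun m => -alternatingHagg m) k (-i) (-j) := by
  rw [barlowPos_neg_alternating, neg_neg, neg_neg]

/-- **The stacking of `−alternatingHagg` is `halfTurn '' hcpStacking a h`.** [folklore] -/
theorem barlowStacking_neg_alternating (a h : ℝ) :
    barlowStacking a h (fun m => -alternatingHagg m) =
      halfTurn.toLinearIsometry '' hcpStacking a h := by
  refine Set.ext fun x => ⟨?_, ?_⟩
  · rintro ⟨k, i, j, rfl⟩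
    exact ⟨barlowPos a h alternatingHagg k (-i) (-j), ⟨k, -i, -j, rfl⟩,
      (barlowPos_neg_alternating a h k i j).symm⟩
  · rintro ⟨_, ⟨k, i, j, rfl⟩, rfl⟩
    exact ⟨k, -i, -j, halfTurn_barlowPos_alternating a h k i j⟩

/-! ## The stub -/

/-- **Stub 6 of line `c-layer-witness-strictness` — the c-layer witness selects hcp** (Barlow
arithmetic, no energetics). If a Barlow stacking `barlowStacking a h s` (`a, h > 0`, `s` Hägg, any
ratio) realises the squared distance `16a²/3 + 4h²` between NO two of its points, then it is
`hcpStacking a h` up to a linear isometry (the identity or the half-turn about `e₃`): a cubic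
letter `s m = s (m+1)` would produce the pair `barlowPos (m+2) 0 0`, `barlowPos m (2σ) (−2σ)` at
exactly that squared distance, so the word alternates, `s = ±alternatingHagg`, and
`barlowStacking a h (−alternatingHagg) = halfTurn '' hcpStacking a h`. [folklore] -/
theorem stub_witness :
    ∀ (a h : ℝ), 0 < a → 0 < h → ∀ s : ℤ → ℤ, IsHaggSeq s →
      (∀ x ∈ barlowStacking a h s, ∀ y ∈ barlowStacking a h s,
        dist x y ^ 2 ≠ 16 * a ^ 2 / 3 + 4 * h ^ 2) →
      ∃ B : E3 →ₗᵢ[ℝ] E3, barlowStacking a h s = B '' hcpStacking a h := by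
  intro a h _ _ s hs hnot
  have hmul : ∀ m, s m = s 0 * alternatingHagg m :=
    eq_mul_alternatingHagg (succ_eq_neg_of_forall_dist_sq_ne a h hs hnot)
  rcases hs 0 with h0 | h0
  · obtain rfl : s = alternatingHagg := funext fun m => by rw [hmul, h0, one_mul]
    exact ⟨LinearIsometry.id, by simp [hcpStacking]⟩
  · obtain rfl : s = fun m => -alternatingHagg m := funext fun m => by rw [hmul, h0]; ring
    exact ⟨halfTurn.toLinearIsometry, barlowStacking_neg_alternating a h⟩

end Summit.AtomisticToContinuum.Crystallization.Theorems.CLayerWitnessWitness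

end
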